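import Summits.CriticalPhenomena.PercolationContinuityZ3.Theorems.PercNearOneGluingNoHeavyLowerTailSahiThreeCopyTwoPoint

/-!
# `NoHeavyLowerTail` (crux stmt-CriticalPhenomena-4575), Sahi programme: **THE MATRIX-SANDWICH REDUCTION** — 3C-SAHI for a free front slot
# against two ARBITRARY slots in every dimension from an entrywise-nonnegative MATRIX certificate `S` on pairs of levels
# (`R(V,W) ≤ 1_Vᵀ S 1_W ≤ c(V∩W)`), generalising the two-point (diagonal) certificate of `…SahiThreeCopyTwoPoint`

Support file (Sahi cell, seat `prim-sahi-p1`, generation 60; `--supports stmt-CriticalPhenomena-4575`).  Pure proofs, standard axioms; three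
small definitions (`A1form`, `A2form`, `Sform`).

WHY.  The two-point reduction `tc_frontFn_nonneg_of_twoPoint` converts, arrangement by arrangement, the same-copy products `G_{e₁}H_{e₁}` into
cross-copy products by three-copy Harris with a DIAGONAL weight `θ(e₁,e₂,e₃)`; generation 60 showed (`…TwoPointRefutation`, `not_twoPoint_C8`)
that such diagonal certificates do not exist for `C₈ = (x₀∨x₁)(x₂∨x₃)(x₄∨x₅)(x₆∨x₇)` and for every AND of `≥ 3` disjoint ORs on `≥ 7` variables.
But Harris on the back cube holds for EVERY pair of levels: `N_b(G_e H_{e'};1;1) ≥ N_b(G_e; H_{e'}; 1)` (`N3_le_N3_mul`), so one may spend an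
arbitrary entrywise-nonnegative matrix `S = (S_{ee'})` of Harris slack.  With `A₁(φ,ψ) = Σ_arr[2f(e₁)φ(e₁)ψ(e₁) − f(e₁)φ(e₂)ψ(e₂)]` (on up-set
indicators: `c(V∩W)`), `A₂(φ,ψ) = Σ_arr[f(e₁)φ(e₂)ψ(e₃) − f(e₂)φ(e₁)ψ(e₂) − f(e₂)φ(e₂)ψ(e₁)]` (on indicators: `−R(V,W)`) and
`S(φ,ψ) = Σ_{e,e'} S_{ee'} φ(e)ψ(e')`:
* ★★ `tc_frontFn_nonneg_of_matrixSandwich`: if `S ≥ 0` entrywise and (M1) `S(φ,ψ) ≤ A₁(φ,ψ)`, (M2) `−A₂(φ,ψ) ≤ S(φ,ψ)` for all pairs of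
  nonnegative monotone level functions, then `0 ≤ c_{(π,b)}(frontFn f, G, H)` for every back profile `b` in every dimension and all
  nonnegative monotone `G, H`.  Proof: token form; subtract the total Harris slack `Σ S_{ee'}[N(G_eH_{e'};1;1) − N(G_e;H_{e'};1)] ≥ 0`; what
  remains is a sum over back arrangements of the pointwise kernel `[A₁ − S](G(x),H(x)) + [S + A₂](G(x),H(y)) ≥ 0`.
* `tc_frontFn_nonneg_of_matrixSandwich_upSets`: the same with (M1), (M2) only on pairs of indicators of up-sets `V, W` (bilinearity + finite
  layer cake, `bilin_nonneg_of_upperSets`), i.e. the MATRIX SANDWICH  `R(V,W) ≤ Σ_{e∈V,e'∈W} S_{ee'} ≤ c(V∩W)`  (memo FROM-prim-sahi-p1-gen60 §4).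
The diagonal case `S_{ee} = Σ_{arr: e₁=e} θ`, `S_{ee'} = 0` (`e ≠ e'`) is exactly the two-point certificate.  Nothing conjectural is used.
[this work]
-/

namespace Summit.CriticalPhenomena.PercolationContinuityZ3.Theorems.SahiThreeCopy

open Finset Function Literature.Combinatorics.Sahi2008
open scoped BigOperators

noncomputable section

variable {d : ℕ}

/-! ### §1 The three forms -/

section Forms

variable {k : ℕ}

/-- `A₁(φ,ψ) = Σ_arr [2f(e₁)φ(e₁)ψ(e₁) − f(e₁)φ(e₂)ψ(e₂)]` (the `θ`-free part of (N1); on up-set indicators `c(V∩W)`). [this work] -/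
def A1form (k : ℕ) (π : Fin k → ℕ) (f : Pt k → ℝ) (φ ψ : Pt k → ℝ) : ℝ :=
  ∑ σ : Pt k × Pt k × Pt k, arrInd π σ.1 σ.2.1 σ.2.2 * (2 * f σ.1 * (φ σ.1 * ψ σ.1) - f σ.1 * (φ σ.2.1 * ψ σ.2.1))

/-- `A₂(φ,ψ) = Σ_arr [f(e₁)φ(e₂)ψ(e₃) − f(e₂)φ(e₁)ψ(e₂) − f(e₂)φ(e₂)ψ(e₁)]` (the `θ`-free part of (N2); on up-set indicators `−R(V,W)`). [this work] -/
def A2form (k : ℕ) (π : Fin k → ℕ) (f : Pt k → ℝ) (φ ψ : Pt k → ℝ) : ℝ :=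
  ∑ σ : Pt k × Pt k × Pt k, arrInd π σ.1 σ.2.1 σ.2.2 *
    (f σ.1 * (φ σ.2.1 * ψ σ.2.2) - f σ.2.1 * (φ σ.1 * ψ σ.2.1) - f σ.2.1 * (φ σ.2.1 * ψ σ.1))

/-- The bilinear form of the matrix certificate: `S(φ,ψ) = Σ_{e,e'} S_{ee'} φ(e) ψ(e')`. [this work] -/
def Sform (S : Pt k → Pt k → ℝ) (φ ψ : Pt k → ℝ) : ℝ :=
  ∑ p : Pt k × Pt k, S p.1 p.2 * (φ p.1 * ψ p.2)

/-- `A₁` is additive in the first argument. [this work] -/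
theorem A1form_add₁ (π : Fin k → ℕ) (f φ φ' ψ : Pt k → ℝ) : A1form k π f (φ + φ') ψ = A1form k π f φ ψ + A1form k π f φ' ψ := by
  unfold A1form; rw [← sum_add_distrib]; exact sum_congr rfl fun σ _ => by simp only [Pi.add_apply]; ring
/-- `A₁` is homogeneous in the first argument. [this work] -/
theorem A1form_smul₁ (π : Fin k → ℕ) (f : Pt k → ℝ) (c : ℝ) (φ ψ : Pt k → ℝ) : A1form k π f (c • φ) ψ = c * A1form k π f φ ψ := by
  unfold A1form; rw [mul_sum]; exact sum_congr rfl fun σ _ => by simp only [Pi.smul_apply, smul_eq_mul]; ring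
/-- `A₁` is additive in the second argument. [this work] -/
theorem A1form_add₂ (π : Fin k → ℕ) (f φ ψ ψ' : Pt k → ℝ) : A1form k π f φ (ψ + ψ') = A1form k π f φ ψ + A1form k π f φ ψ' := by
  unfold A1form; rw [← sum_add_distrib]; exact sum_congr rfl fun σ _ => by simp only [Pi.add_apply]; ring
/-- `A₁` is homogeneous in the second argument. [this work] -/
theorem A1form_smul₂ (π : Fin k → ℕ) (f : Pt k → ℝ) (c : ℝ) (φ ψ : Pt k → ℝ) : A1form k π f φ (c • ψ) = c * A1form k π f φ ψ := by
  unfold A1form; rw [mul_sum]; exact sum_congr rfl fun σ _ => by simp only [Pi.smul_apply, smul_eq_mul]; ring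
/-- `A₂` is additive in the first argument. [this work] -/
theorem A2form_add₁ (π : Fin k → ℕ) (f φ φ' ψ : Pt k → ℝ) : A2form k π f (φ + φ') ψ = A2form k π f φ ψ + A2form k π f φ' ψ := by
  unfold A2form; rw [← sum_add_distrib]; exact sum_congr rfl fun σ _ => by simp only [Pi.add_apply]; ring
/-- `A₂` is homogeneous in the first argument. [this work] -/
theorem A2form_smul₁ (π : Fin k → ℕ) (f : Pt k → ℝ) (c : ℝ) (φ ψ : Pt k → ℝ) : A2form k π f (c • φ) ψ = c * A2form k π f φ ψ := by
  unfold A2form; rw [mul_sum]; exact sum_congr rfl fun σ _ => by simp only [Pi.smul_apply, smul_eq_mul]; ring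
/-- `A₂` is additive in the second argument. [this work] -/
theorem A2form_add₂ (π : Fin k → ℕ) (f φ ψ ψ' : Pt k → ℝ) : A2form k π f φ (ψ + ψ') = A2form k π f φ ψ + A2form k π f φ ψ' := by
  unfold A2form; rw [← sum_add_distrib]; exact sum_congr rfl fun σ _ => by simp only [Pi.add_apply]; ring
/-- `A₂` is homogeneous in the second argument. [this work] -/
theorem A2form_smul₂ (π : Fin k → ℕ) (f : Pt k → ℝ) (c : ℝ) (φ ψ : Pt k → ℝ) : A2form k π f φ (c • ψ) = c * A2form k π f φ ψ := by
  unfold A2form; rw [mul_sum]; exact sum_congr rfl fun σ _ => by simp only [Pi.smul_apply, smul_eq_mul]; ring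
/-- `S(·,·)` is additive in the first argument. [this work] -/
theorem Sform_add₁ (S : Pt k → Pt k → ℝ) (φ φ' ψ : Pt k → ℝ) : Sform S (φ + φ') ψ = Sform S φ ψ + Sform S φ' ψ := by
  unfold Sform; rw [← sum_add_distrib]; exact sum_congr rfl fun p _ => by simp only [Pi.add_apply]; ring
/-- `S(·,·)` is homogeneous in the first argument. [this work] -/
theorem Sform_smul₁ (S : Pt k → Pt k → ℝ) (c : ℝ) (φ ψ : Pt k → ℝ) : Sform S (c • φ) ψ = c * Sform S φ ψ := by
  unfold Sform; rw [mul_sum]; exact sum_congr rfl fun p _ => by simp only [Pi.smul_apply, smul_eq_mul]; ring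
/-- `S(·,·)` is additive in the second argument. [this work] -/
theorem Sform_add₂ (S : Pt k → Pt k → ℝ) (φ ψ ψ' : Pt k → ℝ) : Sform S φ (ψ + ψ') = Sform S φ ψ + Sform S φ ψ' := by
  unfold Sform; rw [← sum_add_distrib]; exact sum_congr rfl fun p _ => by simp only [Pi.add_apply]; ring
/-- `S(·,·)` is homogeneous in the second argument. [this work] -/
theorem Sform_smul₂ (S : Pt k → Pt k → ℝ) (c : ℝ) (φ ψ : Pt k → ℝ) : Sform S φ (c • ψ) = c * Sform S φ ψ := by
  unfold Sform; rw [mul_sum]; exact sum_congr rfl fun p _ => by simp only [Pi.smul_apply, smul_eq_mul]; ring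

end Forms

/-! ### §2 The matrix-sandwich reduction -/

/-- ★★ **THE MATRIX-SANDWICH REDUCTION.**  Let `f` be a real function on the front cube `{0,1}^k`, `π` a front profile, and `S ≥ 0` an
entrywise-nonnegative matrix on pairs of levels such that for ALL pairs of nonnegative monotone level-functions `φ, ψ`:
(M1) `S(φ,ψ) ≤ A₁(φ,ψ)` and (M2) `−A₂(φ,ψ) ≤ S(φ,ψ)`.  Then `0 ≤ c_{(π,b)}(frontFn f, G, H)` for every back profile `b` in every dimension
and all nonnegative monotone `G, H` on `{0,1}^{d+k}`.  (Diagonal `S` = the two-point reduction.) [this work] -/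
theorem tc_frontFn_nonneg_of_matrixSandwich (k : ℕ) (π : Fin k → ℕ) (f : Pt k → ℝ) (S : Pt k → Pt k → ℝ)
    (hS : ∀ e e', 0 ≤ S e e')
    (hM1 : ∀ φ ψ : Pt k → ℝ, (∀ e, 0 ≤ φ e) → (∀ e, 0 ≤ ψ e) → Monotone φ → Monotone ψ →
      0 ≤ A1form k π f φ ψ - Sform S φ ψ)
    (hM2 : ∀ φ ψ : Pt k → ℝ, (∀ e, 0 ≤ φ e) → (∀ e, 0 ≤ ψ e) → Monotone φ → Monotone ψ →
      0 ≤ Sform S φ ψ + A2form k π f φ ψ)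
    (b : Fin d → ℕ) {G H : Pt (d + k) → ℝ} (hG : ∀ w, 0 ≤ G w) (hH : ∀ w, 0 ≤ H w) (hGm : Monotone G) (hHm : Monotone H) :
    0 ≤ tc (appendProf k π b) (frontFn k f) G H := by
  set Gs : Pt k → Pt d → ℝ := fun e => secF k e G with hGs
  set Hs : Pt k → Pt d → ℝ := fun e => secF k e H with hHs
  have Gs0 : ∀ e y, 0 ≤ Gs e y := fun e y => secF_nonneg k e hG y
  have Hs0 : ∀ e y, 0 ≤ Hs e y := fun e y => secF_nonneg k e hH y
  have Gsm : ∀ e, Monotone (Gs e) := fun e => secF_monotone k e hGm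
  have Hsm : ∀ e, Monotone (Hs e) := fun e => secF_monotone k e hHm
  rw [tc_frontFn_eq, sum3_ite_eq_sum_triple]
  -- normalise the two commuted N3 terms
  have horig : (∑ σ : Pt k × Pt k × Pt k, arrInd π σ.1 σ.2.1 σ.2.2 *
      (2 * f σ.1 * N3 b (secF k σ.1 G * secF k σ.1 H) 1 1 - f σ.1 * N3 b (secF k σ.2.1 G * secF k σ.2.1 H) 1 1
        - f σ.2.1 * N3 b (secF k σ.1 G) (secF k σ.2.1 H) 1 - f σ.2.1 * N3 b (secF k σ.1 H) (secF k σ.2.1 G) 1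
        + f σ.1 * N3 b 1 (secF k σ.2.1 G) (secF k σ.2.2 H))) =
      ∑ σ : Pt k × Pt k × Pt k, arrInd π σ.1 σ.2.1 σ.2.2 *
        (2 * f σ.1 * N3 b (Gs σ.1 * Hs σ.1) 1 1 - f σ.1 * N3 b (Gs σ.2.1 * Hs σ.2.1) 1 1
          - f σ.2.1 * N3 b (Gs σ.1) (Hs σ.2.1) 1 - f σ.2.1 * N3 b (Gs σ.2.1) (Hs σ.1) 1 + f σ.1 * N3 b (Gs σ.2.1) (Hs σ.2.2) 1) := by
    refine sum_congr rfl fun σ _ => ?_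
    have e1 : N3 b (secF k σ.1 H) (secF k σ.2.1 G) 1 = N3 b (Gs σ.2.1) (Hs σ.1) 1 := N3_comm12 b _ _ _
    have e2 : N3 b 1 (secF k σ.2.1 G) (secF k σ.2.2 H) = N3 b (Gs σ.2.1) (Hs σ.2.2) 1 := by rw [N3_comm12, N3_comm23]
    rw [e1, e2]
  rw [horig]
  -- the total Harris slack spent by `S`
  have slack : 0 ≤ ∑ p : Pt k × Pt k, S p.1 p.2 * (N3 b (Gs p.1 * Hs p.2) 1 1 - N3 b (Gs p.1) (Hs p.2) 1) :=
    sum_nonneg fun p _ => mul_nonneg (hS _ _)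
      (sub_nonneg.2 (N3_le_N3_mul d b (Gs p.1) (Hs p.2) 1 (Gs0 p.1) (Gsm p.1) (Hs0 p.2) (Hsm p.2) fun _ => zero_le_one))
  -- kernel form of the main sum
  have hA : (∑ σ : Pt k × Pt k × Pt k, arrInd π σ.1 σ.2.1 σ.2.2 *
      (2 * f σ.1 * N3 b (Gs σ.1 * Hs σ.1) 1 1 - f σ.1 * N3 b (Gs σ.2.1 * Hs σ.2.1) 1 1
        - f σ.2.1 * N3 b (Gs σ.1) (Hs σ.2.1) 1 - f σ.2.1 * N3 b (Gs σ.2.1) (Hs σ.1) 1 + f σ.1 * N3 b (Gs σ.2.1) (Hs σ.2.2) 1)) =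
      ∑ τ : Pt d × Pt d × Pt d, arrInd b τ.1 τ.2.1 τ.2.2 *
        (A1form k π f (fun e => Gs e τ.1) (fun e => Hs e τ.1) + A2form k π f (fun e => Gs e τ.1) (fun e => Hs e τ.2.1)) := by
    simp only [N3_eq_sum_triple, A1form, A2form, Pi.mul_apply, Pi.one_apply, mul_one, mul_sum, ← sum_sub_distrib, ← sum_add_distrib]
    rw [sum_comm]
    refine sum_congr rfl fun τ _ => sum_congr rfl fun σ _ => ?_
    ring
  -- kernel form of the slack
  have hB : (∑ p : Pt k × Pt k, S p.1 p.2 * (N3 b (Gs p.1 * Hs p.2) 1 1 - N3 b (Gs p.1) (Hs p.2) 1)) =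
      ∑ τ : Pt d × Pt d × Pt d, arrInd b τ.1 τ.2.1 τ.2.2 *
        (Sform S (fun e => Gs e τ.1) (fun e => Hs e τ.1) - Sform S (fun e => Gs e τ.1) (fun e => Hs e τ.2.1)) := by
    simp only [N3_eq_sum_triple, Sform, Pi.mul_apply, Pi.one_apply, mul_one, mul_sum, ← sum_sub_distrib]
    rw [sum_comm]
    refine sum_congr rfl fun τ _ => sum_congr rfl fun p _ => ?_
    ring
  -- main = (main − slack) + slack
  have key : (∑ σ : Pt k × Pt k × Pt k, arrInd π σ.1 σ.2.1 σ.2.2 *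
      (2 * f σ.1 * N3 b (Gs σ.1 * Hs σ.1) 1 1 - f σ.1 * N3 b (Gs σ.2.1 * Hs σ.2.1) 1 1
        - f σ.2.1 * N3 b (Gs σ.1) (Hs σ.2.1) 1 - f σ.2.1 * N3 b (Gs σ.2.1) (Hs σ.1) 1 + f σ.1 * N3 b (Gs σ.2.1) (Hs σ.2.2) 1)) =
      ((∑ σ : Pt k × Pt k × Pt k, arrInd π σ.1 σ.2.1 σ.2.2 *
        (2 * f σ.1 * N3 b (Gs σ.1 * Hs σ.1) 1 1 - f σ.1 * N3 b (Gs σ.2.1 * Hs σ.2.1) 1 1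
          - f σ.2.1 * N3 b (Gs σ.1) (Hs σ.2.1) 1 - f σ.2.1 * N3 b (Gs σ.2.1) (Hs σ.1) 1 + f σ.1 * N3 b (Gs σ.2.1) (Hs σ.2.2) 1)) -
       ∑ p : Pt k × Pt k, S p.1 p.2 * (N3 b (Gs p.1 * Hs p.2) 1 1 - N3 b (Gs p.1) (Hs p.2) 1)) +
      ∑ p : Pt k × Pt k, S p.1 p.2 * (N3 b (Gs p.1 * Hs p.2) 1 1 - N3 b (Gs p.1) (Hs p.2) 1) := by ring
  rw [key]
  refine add_nonneg ?_ slack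
  rw [hA, hB, ← sum_sub_distrib]
  refine sum_nonneg fun τ _ => ?_
  rw [← mul_sub]
  refine mul_nonneg (arrInd_nonneg b _ _ _) ?_
  have lvl_mono_G : ∀ y, Monotone (fun e => Gs e y) := fun y e e' hee' => secF_mono_level k hee' hGm y
  have lvl_mono_H : ∀ y, Monotone (fun e => Hs e y) := fun y e e' hee' => secF_mono_level k hee' hHm y
  have h1 := hM1 (fun e => Gs e τ.1) (fun e => Hs e τ.1) (fun e => Gs0 e _) (fun e => Hs0 e _) (lvl_mono_G _) (lvl_mono_H _)
  have h2 := hM2 (fun e => Gs e τ.1) (fun e => Hs e τ.2.1) (fun e => Gs0 e _) (fun e => Hs0 e _) (lvl_mono_G _) (lvl_mono_H _)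
  linarith

/-- ★★ **THE MATRIX SANDWICH, up-set form.**  If `S ≥ 0` entrywise and `R(V,W) ≤ Σ_{e∈V, e'∈W} S_{ee'} ≤ c(V∩W)` for all up-sets
`V, W ⊆ {0,1}^k` — in the forms of §1: `S(1_V,1_W) ≤ A₁(1_V,1_W)` and `−A₂(1_V,1_W) ≤ S(1_V,1_W)` — then `c_{(π,b)}(frontFn f, G, H) ≥ 0`
for every back profile in every dimension and all nonnegative monotone `G, H`. [this work] -/
theorem tc_frontFn_nonneg_of_matrixSandwich_upSets (k : ℕ) (π : Fin k → ℕ) (f : Pt k → ℝ) (S : Pt k → Pt k → ℝ)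
    (hS : ∀ e e', 0 ≤ S e e')
    (hU : ∀ V W : Finset (Pt k), IsUpperSet (V : Set (Pt k)) → IsUpperSet (W : Set (Pt k)) →
      0 ≤ A1form k π f (setInd V) (setInd W) - Sform S (setInd V) (setInd W))
    (hL : ∀ V W : Finset (Pt k), IsUpperSet (V : Set (Pt k)) → IsUpperSet (W : Set (Pt k)) →
      0 ≤ Sform S (setInd V) (setInd W) + A2form k π f (setInd V) (setInd W))
    (b : Fin d → ℕ) {G H : Pt (d + k) → ℝ} (hG : ∀ w, 0 ≤ G w) (hH : ∀ w, 0 ≤ H w) (hGm : Monotone G) (hHm : Monotone H) :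
    0 ≤ tc (appendProf k π b) (frontFn k f) G H := by
  refine tc_frontFn_nonneg_of_matrixSandwich k π f S hS ?_ ?_ b hG hH hGm hHm
  · intro φ ψ hφ hψ hφm hψm
    refine bilin_nonneg_of_upperSets (fun φ ψ => A1form k π f φ ψ - Sform S φ ψ) ?_ ?_ ?_ ?_ hU hφ hψ hφm hψm
    · intro φ φ' ψ; simp only [A1form_add₁, Sform_add₁]; ring
    · intro c φ ψ; simp only [A1form_smul₁, Sform_smul₁]; ring
    · intro φ ψ ψ'; simp only [A1form_add₂, Sform_add₂]; ring
    · intro c φ ψ; simp only [A1form_smul₂, Sform_smul₂]; ring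
  · intro φ ψ hφ hψ hφm hψm
    refine bilin_nonneg_of_upperSets (fun φ ψ => Sform S φ ψ + A2form k π f φ ψ) ?_ ?_ ?_ ?_ hL hφ hψ hφm hψm
    · intro φ φ' ψ; simp only [A2form_add₁, Sform_add₁]; ring
    · intro c φ ψ; simp only [A2form_smul₁, Sform_smul₁]; ring
    · intro φ ψ ψ'; simp only [A2form_add₂, Sform_add₂]; ring
    · intro c φ ψ; simp only [A2form_smul₂, Sform_smul₂]; ring

/-- The two-point certificate is the diagonal case: from `θ ≥ 0` with (N1), (N2) one gets the matrix hypotheses with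
`S_{ee} = Σ_{arr: e₁ = e} θ`, `S_{ee'} = 0` otherwise — recorded as the identity of the diagonal form with `T_θ`. [this work] -/
theorem Sform_diag_eq (k : ℕ) (π : Fin k → ℕ) (θ : Pt k → Pt k → Pt k → ℝ) (φ ψ : Pt k → ℝ) :
    Sform (fun e e' => if e = e' then ∑ σ : Pt k × Pt k × Pt k, (if σ.1 = e then arrInd π σ.1 σ.2.1 σ.2.2 * θ σ.1 σ.2.1 σ.2.2 else 0) else 0) φ ψ =
      ∑ σ : Pt k × Pt k × Pt k, arrInd π σ.1 σ.2.1 σ.2.2 * (θ σ.1 σ.2.1 σ.2.2 * (φ σ.1 * ψ σ.1)) := by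
  classical
  unfold Sform
  rw [Fintype.sum_prod_type]
  simp only
  -- inner sum over e' collapses to e' = e
  have h1 : ∀ e : Pt k, (∑ e' : Pt k, (if e = e' then ∑ σ : Pt k × Pt k × Pt k,
      (if σ.1 = e then arrInd π σ.1 σ.2.1 σ.2.2 * θ σ.1 σ.2.1 σ.2.2 else 0) else 0) * (φ e * ψ e')) =
      (∑ σ : Pt k × Pt k × Pt k, (if σ.1 = e then arrInd π σ.1 σ.2.1 σ.2.2 * θ σ.1 σ.2.1 σ.2.2 else 0)) * (φ e * ψ e) := by
    intro e
    rw [Finset.sum_eq_single e]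
    · simp
    · intro e' _ hne; simp [Ne.symm hne]
    · intro h; exact absurd (mem_univ _) h
  simp only [h1, sum_mul]
  rw [sum_comm]
  refine sum_congr rfl fun σ _ => ?_
  rw [Finset.sum_eq_single σ.1]
  · simp only [if_true]; ring
  · intro e _ hne; rw [if_neg (Ne.symm hne)]; ring
  · intro h; exact absurd (mem_univ _) h

end

end Summit.CriticalPhenomena.PercolationContinuityZ3.Theorems.SahiThreeCopy
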